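import Summits.AtomisticToContinuum.Crystallization.Theorems.ChargedEnergyGapVolterraTransferA
import HarnessLib

/-!
# «VolterraTransfer» (lens-3 g54 P-B, line 14231) — part B (sequel of `…ChargedEnergyGapVolterraTransferA`)
LANDING BANNER (critic row 1115 (6); landing lane hand-2 g31): the (H𝄪)/(N𝄪)-type RECORD pieces of this lens-3 g53–g56 engine are VACUOUS at μ₀ > 0 — `harmStableWith_nonpos` (lens-3 g61, `…ChargedEnergyGapRotationGauge`); superseded by the …R designate ((H𝄪ʳ) `LocalSeamTransferBoundR`, (N𝄪ʳ) `LocalSeamReductionR` of `…ChargedEnergyGapRotationRepair`).  Landed as an ENGINE: the transfer / reduction lemmas below are consumed by P-I.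

Split for the 400-line cap by the landing lane (hand-2 g29); the module docstring of part A describes the whole node.  Same namespace; all FQNs unchanged.
0 sorry; standard axioms.
-/

noncomputable section
open scoped Classical
open Literature.MathematicalPhysics.StatisticalMechanics
open Literature.Geometry.DiscreteGeometry
open Summit.AtomisticToContinuum.Crystallization.Theses.PricedLinkCensus
open Summit.AtomisticToContinuum.Crystallization.Theorems.ChargedEnergyGapNegative

namespace Summit.AtomisticToContinuum.Crystallization.Theorems.ChargedEnergyGapChartDial

/-! ## §2 Cut systems, the two pieces, (H♯) ⟹ (H♭), (N♭) ⟹ (N♯), glue, WEAKER, dials -/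

section Pieces

variable (r_S : ℝ) (P : PeriodicConfiguration 3) {k : ℕ} (S : Fin k → CutPiece)

/-- A **CUT SYSTEM** of in-radius `r_S` for the reference `P`: every piece is PLANAR (its normal is orthogonal to both edges), its
Burgers vector is QUANTISED (a stabiliser translation of the reference point set), its planar in-radius is at least `r_S` (no
point-like or needle-like pieces — the load-bearing exclusion), and every reference bond that crosses a translate of a piece does so
TRANSVERSALLY (general position; it makes the jump antisymmetric and excludes in-plane crossings). -/
def IsCutSystem : Prop :=
  (∀ i, inner ℝ (S i).normal (S i).edge₁ = 0 ∧ inner ℝ (S i).normal (S i).edge₂ = 0) ∧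
  (∀ i, (S i).burgers ∈ transSet P) ∧
  (∀ i, (S i).HasInradius r_S) ∧
  (∀ i, ∀ g ∈ P.lattice, ∀ y ∈ P.points, ∀ z ∈ P.points,
    ((S i).shift g).Crosses y z → inner ℝ (z - y) (S i).normal ≠ 0)

variable {r_S P S}

/-- The empty cut system is a cut system at every in-radius. -/
theorem isCutSystem_fin_zero (S : Fin 0 → CutPiece) : IsCutSystem r_S P S :=
  ⟨fun i => i.elim0, fun i => i.elim0, fun i => i.elim0, fun i => i.elim0⟩

/-- The in-radius condition is antitone in the threshold: a larger disc contains the smaller one. -/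
theorem CutPiece.HasInradius.anti {F : CutPiece} {ρ ρ' : ℝ} (hρ : ρ ≤ ρ') (h : F.HasInradius ρ') : F.HasInradius ρ := by
  obtain ⟨c, hc0, hc⟩ := h
  exact ⟨c, hc0, fun q hq hplane => hc q (hq.trans hρ) hplane⟩

/-- Cut systems are antitone in the in-radius threshold. -/
theorem IsCutSystem.anti {r_S' : ℝ} (hr : r_S ≤ r_S') (h : IsCutSystem r_S' P S) : IsCutSystem r_S P S :=
  ⟨h.1, h.2.1, fun i => (h.2.2.1 i).anti hr, h.2.2.2⟩

/-- ★ On reference bonds the cut jump of a cut system is ANTISYMMETRIC (transversality). -/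
theorem cutJump_swap (h : IsCutSystem r_S P S) {y z : E3} (hy : y ∈ P.points) (hz : z ∈ P.points) :
    cutJump P S z y = -cutJump P S y z := by
  simp only [cutJump]
  rw [← Finset.sum_neg_distrib]
  refine Finset.sum_congr rfl fun i _ => ?_
  rw [← finsum_neg_distrib]
  refine finsum_congr fun g => ?_
  exact CutPiece.jump_swap _ (h.2.2.2 i (g : E3) g.2 y hy z hz)

/-- ★ … hence so is the Volterra bond field of a global cocycle and a cut system. -/
theorem volterraField_swap {β₀ : E3 → E3 → E3} (h₀ : IsGlobalCocycle P β₀) (h : IsCutSystem r_S P S) {y z : E3}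
    (hy : y ∈ P.points) (hz : z ∈ P.points) : volterraField P S β₀ z y = -volterraField P S β₀ y z := by
  simp only [volterraField, h₀.1 y hy z hz, cutJump_swap h hy hz, neg_add]

variable (s lam ℓ μ₀ τ lamQ ϱ r_S C_T : ℝ)

/-- piece VOLTERRA-TRANSFER(`C_T`, `r_S`) · STRONGER than HARM-TRANSFER♭ (`harmonicTransferBoundC_of_volterra`) · UNDECIDED→TRUE-leaning
at the record · INSTRUMENTABLE (via (H); directly: ask C15) · ATTACKABLE-M+.  **THE VOLTERRA TRANSFER BOUND**: some `C_H ≥ 0` such that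
for every `s`-separated, Barlow-labelled reference `P` in force and stress equilibrium with stability margin `μ₀` over global cocycles,
every `Λ_P`-invariant centre set `C` and excised set `X`, every global bond cocycle `β₀` and every cut system `S` of in-radius `≥ r_S`
(planar pieces, Burgers vectors in `T(P)`, transversal to reference bonds) whose Volterra bond field `β₀ + J_S` has strain `≤ τ` on
non-excised pairs, the profile-weighted harmonic model of the far account evaluated on `β₀ + J_S` is at least
`−C_T·(model shell count) − C_H·(priced excised count)`.  Why it might fail: everything that threatens (H♭) (a curved or creased shell,
a polytype reference, a soft Bloch sector near the margin `μ₀`), PLUS a cored line whose net Burgers vector `b` threads a shell in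
which the two linear Volterra terms (cut-surface `∇w`-moment `≈ 0.04·‖b‖` and branch-times-ghost-force `≈ 0.1·‖b‖` per unit length,
memo g54 §2) beat the weighted shell share `≈ 1.2·λ·‖b‖²` of the line energy for the softest LJ shear (estimated margin `×4` at
`λ = 1/2`, `‖b‖ ≥ 0.97`), or the local indefiniteness of the bond-wise quadratic form along free in-zone rims costing more than the
in-zone toggle estimate `≈ 2 %` of the shell budget. -/
def VolterraTransferBoundC : Prop :=
  ∃ C_H : ℝ, 0 ≤ C_H ∧ ∀ (P : PeriodicConfiguration 3) (C X : Set E3) (β₀ : E3 → E3 → E3) (k : ℕ) (S : Fin k → CutPiece),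
    IsSeparatedRef s P → IsLabelledRef lam ℓ P → IsForceFree P → IsStressFree P → HarmStableWith μ₀ P →
    IsInvariantSet P C → IsInvariantSet P X → IsGlobalCocycle P β₀ → IsCutSystem r_S P S →
    SmallStrain τ P X (volterraField P S β₀) →
      -(C_T * (modelShellCount P X ϱ C : ℝ)) - C_H * (pricedExcisedCount P X ϱ C : ℝ) ≤
        modelFar (volterraField P S β₀) P X lamQ ϱ C

variable {s lam ℓ μ₀ τ lamQ ϱ r_S C_T}

/-- ★ **(H♯) ⟹ (H♭)**: the Volterra transfer bound implies the harmonic transfer bound for global cocycles (the empty cut system). -/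
theorem harmonicTransferBoundC_of_volterra (h : VolterraTransferBoundC s lam ℓ μ₀ τ lamQ ϱ r_S C_T) :
    HarmonicTransferBoundC s lam ℓ μ₀ τ lamQ ϱ C_T := by
  obtain ⟨C_H, hH, h⟩ := h
  refine ⟨C_H, hH, fun P C X β h1 h2 h3 h4 h5 h6 h7 h8 h9 => ?_⟩
  have key := h P C X β 0 Fin.elim0 h1 h2 h3 h4 h5 h6 h7 h8 (isCutSystem_fin_zero _)
    (by rw [volterraField_fin_zero]; exact h9)
  rwa [volterraField_fin_zero] at key

/-- … and hence the displacement-field version (H), the census kill path of record: a refutation of (H) refutes (H♯). -/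
theorem harmonicTransferBound_of_volterra (h : VolterraTransferBoundC s lam ℓ μ₀ τ lamQ ϱ r_S C_T) :
    HarmonicTransferBound s lam ℓ μ₀ τ lamQ ϱ C_T :=
  harmonicTransferBound_of_cocycle (harmonicTransferBoundC_of_volterra h)

variable (s lam ℓ μ₀ τ lamQ ϱ r_S C_T)
variable {θ ε R r η L δ L' : ℝ} (W : CoreWeights θ ε R r η L δ L' ϱ) (c₁ ρ₀ B₀ : ℝ)

/-- piece VOLTERRA-REDUCTION_W · WEAKER than HARM-REDUCTION_W (`volterraReductionW_of_harmonicReduction`) and than CB-FAR_W|cored,`B₀`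
(`volterraReductionW_of_budget`) · UNDECIDED (TRUE-leaning with the leaf for the max cover) · ATTACKABLE-L (far regions that are ONE
periodic Barlow polytype up to elastic distortion, with ARBITRARY centred perfect-dislocation content and priced holes) | IDEA-NEEDED
(reference switching: fault ribbons wider than the core zone, grains, twins).  **THE VOLTERRA REDUCTION**: the Volterra transfer bound
implies the budget far leaf.  Content (memo g54 §3): as (N♭), with the far region now charted by a global cocycle PLUS a glide cut system
(`b ∈ T(P)` re-pairs the reference sites across each seam, so the actual configuration is Taylor-expanded about reference bonds with
small distortion everywhere off the core zones; prismatic components through glide cylinders; narrow dipoles cut the long way round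
the cell); the seams are placed off the sites (transversality) at the prover's discretion.  Why it might fail: only with the leaf (it is
implied by it) — as a PROOF TASK it is open where the far region switches reference: fault ribbons of dissociated partials wider than
`ϱ/8` (partial Burgers vectors are not in `T(P)`; census C14), grain boundaries, twins. -/
def VolterraReductionW : Prop :=
  VolterraTransferBoundC s lam ℓ μ₀ τ lamQ ϱ r_S C_T → FarLabelledFloorCoredBudgetW W c₁ s ρ₀ lam ℓ B₀

variable {s lam ℓ μ₀ τ lamQ ϱ r_S C_T W c₁ ρ₀ B₀}

/-- ★ **THE SPLIT** (glue, proved; bridge split by modus ponens): VOLTERRA-TRANSFER ∧ VOLTERRA-REDUCTION_W ⟹ CB-FAR_W|cored,`B₀`. -/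
theorem farLabelledFloorCoredBudgetW_of_volterra (hV : VolterraTransferBoundC s lam ℓ μ₀ τ lamQ ϱ r_S C_T)
    (hN : VolterraReductionW s lam ℓ μ₀ τ lamQ ϱ r_S C_T W c₁ ρ₀ B₀) : FarLabelledFloorCoredBudgetW W c₁ s ρ₀ lam ℓ B₀ :=
  hN hV

/-- ★ WEAKER: HARM-REDUCTION_W ⟹ VOLTERRA-REDUCTION_W (the reduction got easier: its hypothesis got stronger). -/
theorem volterraReductionW_of_harmonicReduction (h : HarmonicReductionW s lam ℓ μ₀ τ lamQ ϱ C_T W c₁ ρ₀ B₀) :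
    VolterraReductionW s lam ℓ μ₀ τ lamQ ϱ r_S C_T W c₁ ρ₀ B₀ :=
  fun hV => h (harmonicTransferBoundC_of_volterra hV)

/-- WEAKER: the budget far leaf implies VOLTERRA-REDUCTION_W at every dial. -/
theorem volterraReductionW_of_budget (h : FarLabelledFloorCoredBudgetW W c₁ s ρ₀ lam ℓ B₀) :
    VolterraReductionW s lam ℓ μ₀ τ lamQ ϱ r_S C_T W c₁ ρ₀ B₀ :=
  fun _ => h

/-- The three-generation chain in one line: SHELL-BUDGET_W ∧ VOLTERRA-TRANSFER ∧ VOLTERRA-REDUCTION_W ⟹ CB-FAR_W|cored (parts O-D, P-A, P-B). -/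
theorem farLabelledFloorCoredW_of_volterra_shellBudget (hS : ShellBudgetW W s B₀)
    (hV : VolterraTransferBoundC s lam ℓ μ₀ τ lamQ ϱ r_S C_T) (hN : VolterraReductionW s lam ℓ μ₀ τ lamQ ϱ r_S C_T W c₁ ρ₀ B₀) :
    FarLabelledFloorCoredW W c₁ s ρ₀ lam ℓ :=
  farLabelledFloorCoredW_of_shellBudget W hS (farLabelledFloorCoredBudgetW_of_volterra hV hN)

/-- VOLTERRA-TRANSFER is monotone in the transfer constant `C_T` … -/
theorem VolterraTransferBoundC.mono_CT {C_T' : ℝ} (hC : C_T ≤ C_T') (h : VolterraTransferBoundC s lam ℓ μ₀ τ lamQ ϱ r_S C_T) :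
    VolterraTransferBoundC s lam ℓ μ₀ τ lamQ ϱ r_S C_T' := by
  obtain ⟨C_H, hH, h⟩ := h
  refine ⟨C_H, hH, fun P C X β₀ k S h1 h2 h3 h4 h5 h6 h7 h8 h9 h10 => ?_⟩
  have key := h P C X β₀ k S h1 h2 h3 h4 h5 h6 h7 h8 h9 h10
  have hm : C_T * (modelShellCount P X ϱ C : ℝ) ≤ C_T' * (modelShellCount P X ϱ C : ℝ) :=
    mul_le_mul_of_nonneg_right hC (Nat.cast_nonneg _)
  linarith

/-- … antitone in the strain amplitude `τ` (fewer test data) … -/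
theorem VolterraTransferBoundC.anti_tau {τ' : ℝ} (hτ : τ' ≤ τ) (h : VolterraTransferBoundC s lam ℓ μ₀ τ lamQ ϱ r_S C_T) :
    VolterraTransferBoundC s lam ℓ μ₀ τ' lamQ ϱ r_S C_T := by
  obtain ⟨C_H, hH, h⟩ := h
  refine ⟨C_H, hH, fun P C X β₀ k S h1 h2 h3 h4 h5 h6 h7 h8 h9 h10 => h P C X β₀ k S h1 h2 h3 h4 h5 h6 h7 h8 h9 ?_⟩
  intro y hy z hz hyX hzX
  exact (h10 y hy z hz hyX hzX).trans (mul_le_mul_of_nonneg_right hτ dist_nonneg)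

/-- … monotone in the stability margin `μ₀` (fewer references) … -/
theorem VolterraTransferBoundC.mono_mu {μ₀' : ℝ} (hμ : μ₀ ≤ μ₀') (h : VolterraTransferBoundC s lam ℓ μ₀ τ lamQ ϱ r_S C_T) :
    VolterraTransferBoundC s lam ℓ μ₀' τ lamQ ϱ r_S C_T := by
  obtain ⟨C_H, hH, h⟩ := h
  refine ⟨C_H, hH, fun P C X β₀ k S h1 h2 h3 h4 h5 h6 h7 h8 h9 h10 => h P C X β₀ k S h1 h2 h3 h4 ?_ h6 h7 h8 h9 h10⟩
  intro γ hγ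
  have h0 : 0 ≤ ∑ y ∈ P.motif, dirichletSite γ P y :=
    Finset.sum_nonneg fun y _ => tsum_nonneg fun _ => sq_nonneg _
  exact (mul_le_mul_of_nonneg_right hμ h0).trans (h5 γ hγ)

/-- … monotone in the separation `s` (fewer references) … -/
theorem VolterraTransferBoundC.mono_s {s' : ℝ} (hs : s ≤ s') (h : VolterraTransferBoundC s lam ℓ μ₀ τ lamQ ϱ r_S C_T) :
    VolterraTransferBoundC s' lam ℓ μ₀ τ lamQ ϱ r_S C_T := by
  obtain ⟨C_H, hH, h⟩ := h
  exact ⟨C_H, hH, fun P C X β₀ k S h1 h2 h3 h4 h5 h6 h7 h8 h9 h10 =>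
    h P C X β₀ k S (fun y hy z hz hne => hs.trans (h1 y hy z hz hne)) h2 h3 h4 h5 h6 h7 h8 h9 h10⟩

/-- … antitone in the labelling tolerance `lam` of the reference (fewer references) … -/
theorem VolterraTransferBoundC.anti_lam {lam' : ℝ} (hlam : lam' ≤ lam) (h : VolterraTransferBoundC s lam ℓ μ₀ τ lamQ ϱ r_S C_T) :
    VolterraTransferBoundC s lam' ℓ μ₀ τ lamQ ϱ r_S C_T := by
  obtain ⟨C_H, hH, h⟩ := h
  exact ⟨C_H, hH, fun P C X β₀ k S h1 h2 h3 h4 h5 h6 h7 h8 h9 h10 =>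
    h P C X β₀ k S h1 (fun y hy => (h2 y hy).mono hlam) h3 h4 h5 h6 h7 h8 h9 h10⟩

/-- … and monotone in the in-radius threshold `r_S` (fewer cut systems) — the new dial. -/
theorem VolterraTransferBoundC.mono_rS {r_S' : ℝ} (hr : r_S ≤ r_S') (h : VolterraTransferBoundC s lam ℓ μ₀ τ lamQ ϱ r_S C_T) :
    VolterraTransferBoundC s lam ℓ μ₀ τ lamQ ϱ r_S' C_T := by
  obtain ⟨C_H, hH, h⟩ := h
  exact ⟨C_H, hH, fun P C X β₀ k S h1 h2 h3 h4 h5 h6 h7 h8 h9 h10 =>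
    h P C X β₀ k S h1 h2 h3 h4 h5 h6 h7 h8 (h9.anti hr) h10⟩

/-- VOLTERRA-REDUCTION_W is antitone in `C_T` … -/
theorem VolterraReductionW.anti_CT {C_T' : ℝ} (hC : C_T' ≤ C_T) (h : VolterraReductionW s lam ℓ μ₀ τ lamQ ϱ r_S C_T W c₁ ρ₀ B₀) :
    VolterraReductionW s lam ℓ μ₀ τ lamQ ϱ r_S C_T' W c₁ ρ₀ B₀ :=
  fun hV => h (hV.mono_CT hC)

/-- … monotone in the strain amplitude `τ` … -/
theorem VolterraReductionW.mono_tau {τ' : ℝ} (hτ : τ ≤ τ') (h : VolterraReductionW s lam ℓ μ₀ τ lamQ ϱ r_S C_T W c₁ ρ₀ B₀) :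
    VolterraReductionW s lam ℓ μ₀ τ' lamQ ϱ r_S C_T W c₁ ρ₀ B₀ :=
  fun hV => h (hV.anti_tau hτ)

/-- … antitone in the stability margin `μ₀` … -/
theorem VolterraReductionW.anti_mu {μ₀' : ℝ} (hμ : μ₀' ≤ μ₀) (h : VolterraReductionW s lam ℓ μ₀ τ lamQ ϱ r_S C_T W c₁ ρ₀ B₀) :
    VolterraReductionW s lam ℓ μ₀' τ lamQ ϱ r_S C_T W c₁ ρ₀ B₀ :=
  fun hV => h (hV.mono_mu hμ)

/-- … antitone in the in-radius threshold `r_S` (a reduction may use thinner cut pieces when the transfer bound admits them) … -/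
theorem VolterraReductionW.anti_rS {r_S' : ℝ} (hr : r_S' ≤ r_S) (h : VolterraReductionW s lam ℓ μ₀ τ lamQ ϱ r_S C_T W c₁ ρ₀ B₀) :
    VolterraReductionW s lam ℓ μ₀ τ lamQ ϱ r_S' C_T W c₁ ρ₀ B₀ :=
  fun hV => h (hV.mono_rS hr)

/-- … monotone in the slack `c₁` and antitone in the budget `B₀` (inherited from the leaf). -/
theorem VolterraReductionW.mono_c {c₁' B₀' : ℝ} (hc : c₁ ≤ c₁') (hB : B₀' ≤ B₀)
    (h : VolterraReductionW s lam ℓ μ₀ τ lamQ ϱ r_S C_T W c₁ ρ₀ B₀) : VolterraReductionW s lam ℓ μ₀ τ lamQ ϱ r_S C_T W c₁' ρ₀ B₀' :=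
  fun hV => ((h hV).mono W hc).anti W hB

end Pieces

/-! ## §3 The record dials `(μ₀, τ, λ, r_S, C_T) = (1/100, 3/100, 1/2, 3, 1/(3·10⁶))` and ★★ the ten-leaf cones -/

section Record

/-- Plausibility arithmetic of memo g54 §2 per unit length of a cored line of minimal Burgers vector through a max-cover shell: the
two linear Volterra terms (`0.04 + 0.1`, both taken adversely) against the weighted shell share of the line energy at `λ = 1/2`
(`1.2 · 1/2`): margin above `4`. -/
theorem record_volterra_margin : 4 * ((4 : ℝ) / 100 + 1 / 10) < (12 / 10) * (1 / 2) := by norm_num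

/-- The record in-radius `3` leaves room `20 − 3·2 > 0` for a free in-zone loop of in-radius `3` (the core zone radius is `ϱ/8 = 20` at
`ϱ = 160`): cored dislocation content of any sign is test data, as the reduction needs. -/
theorem record_inradius_fits_zone : 2 * (3 : ℝ) < 160 / 8 := by norm_num

/-- ★★ **THE TEN-LEAF RECORD CONE FOR EVERY WEIGHT SYSTEM**: `ChargeRecount · IP_G · FCP_G · CCP_G · REG-BALL_W · LABEL_W ·
SHELL-BUDGET_W(10⁵) · VOLTERRA-TRANSFER(1/(3·10⁶), 3) · VOLTERRA-REDUCTION_W · P_G ⟹ ChargedEnergyGap` at the record dials, any `ϱ`, any `W`. -/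
theorem chargedEnergyGap_of_volterraLedger {ϱ : ℝ} (W : CoreWeights (3 / 20) (1 / 10) (6 / 5) 10 (1 / 100) 40 (1 / 10) 40 ϱ)
    (hF : ChargeRecount)
    (hIP : ImprovablePricingG (3 / 20) (1 / 10) (6 / 5) 10 (1 / 100) (3 / 5))
    (hFCP : FrustratedCorePricingG (3 / 20) (1 / 10) (6 / 5) 10 (1 / 100) 40 (3 / 5))
    (hCCP : CoherentCorePricingG (3 / 20) (1 / 10) (6 / 5) 10 (1 / 100) 40 (1 / 10) 40 (3 / 5))
    (hB : CoreBallRegularPricingW W (1 / 20) (3 / 5) 10 fun _ _ => True)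
    (hLab : CleanLabellingW W (3 / 5) 10 (1 / 3) 3)
    (hSB : ShellBudgetW W (3 / 5) 100000)
    (hV : VolterraTransferBoundC (3 / 5) (1 / 3) 3 (1 / 100) (3 / 100) (1 / 2) ϱ 3 (1 / 3000000))
    (hN : VolterraReductionW (3 / 5) (1 / 3) 3 (1 / 100) (3 / 100) (1 / 2) ϱ 3 (1 / 3000000) W (1 / 20) 10 100000)
    (hP : ChartedChargePricingG (3 / 20) (1 / 10) (3 / 5)) : ChargedEnergyGap :=
  chargedEnergyGap_of_budgetLedger W hF hIP hFCP hCCP hB hLab hSB (farLabelledFloorCoredBudgetW_of_volterra hV hN) hP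

/-- ★★ **THE MAX-COVER TEN-LEAF RECORD CONE** at `ϱ = 160` (record-designate R1 per critic row 1029): `ChargeRecount · IP_G · FCP_G · CCP_G ·
REG-BALL_M · LABEL_M · SHELL-BUDGET_M(10⁵) · VOLTERRA-TRANSFER(1/(3·10⁶), 3) · VOLTERRA-REDUCTION_M · P_G ⟹ ChargedEnergyGap`. -/
theorem chargedEnergyGap_of_maxCoverVolterraLedger_record (hF : ChargeRecount)
    (hIP : ImprovablePricingG (3 / 20) (1 / 10) (6 / 5) 10 (1 / 100) (3 / 5))
    (hFCP : FrustratedCorePricingG (3 / 20) (1 / 10) (6 / 5) 10 (1 / 100) 40 (3 / 5))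
    (hCCP : CoherentCorePricingG (3 / 20) (1 / 10) (6 / 5) 10 (1 / 100) 40 (1 / 10) 40 (3 / 5))
    (hB : CoreBallRegularPricingW (maxCoverWeights (3 / 20) (1 / 10) (6 / 5) 10 (1 / 100) 40 (1 / 10) 40 160) (1 / 20) (3 / 5) 10
      fun _ _ => True)
    (hLab : CleanLabellingW (maxCoverWeights (3 / 20) (1 / 10) (6 / 5) 10 (1 / 100) 40 (1 / 10) 40 160) (3 / 5) 10 (1 / 3) 3)
    (hSB : ShellBudgetW (maxCoverWeights (3 / 20) (1 / 10) (6 / 5) 10 (1 / 100) 40 (1 / 10) 40 160) (3 / 5) 100000)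
    (hV : VolterraTransferBoundC (3 / 5) (1 / 3) 3 (1 / 100) (3 / 100) (1 / 2) 160 3 (1 / 3000000))
    (hN : VolterraReductionW (3 / 5) (1 / 3) 3 (1 / 100) (3 / 100) (1 / 2) 160 3 (1 / 3000000)
      (maxCoverWeights (3 / 20) (1 / 10) (6 / 5) 10 (1 / 100) 40 (1 / 10) 40 160) (1 / 20) 10 100000)
    (hP : ChartedChargePricingG (3 / 20) (1 / 10) (3 / 5)) : ChargedEnergyGap :=
  chargedEnergyGap_of_maxCoverBudgetLedger_record hF hIP hFCP hCCP hB hLab hSB (farLabelledFloorCoredBudgetW_of_volterra hV hN) hP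

/-- The P-A record cone is RECOVERED from the P-B pieces (consistency of the two generations: (H♯) ⟹ (H♭) and (N♭) given). -/
theorem chargedEnergyGap_of_volterra_via_harmonic {ϱ : ℝ} (W : CoreWeights (3 / 20) (1 / 10) (6 / 5) 10 (1 / 100) 40 (1 / 10) 40 ϱ)
    (hF : ChargeRecount)
    (hIP : ImprovablePricingG (3 / 20) (1 / 10) (6 / 5) 10 (1 / 100) (3 / 5))
    (hFCP : FrustratedCorePricingG (3 / 20) (1 / 10) (6 / 5) 10 (1 / 100) 40 (3 / 5))
    (hCCP : CoherentCorePricingG (3 / 20) (1 / 10) (6 / 5) 10 (1 / 100) 40 (1 / 10) 40 (3 / 5))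
    (hB : CoreBallRegularPricingW W (1 / 20) (3 / 5) 10 fun _ _ => True)
    (hLab : CleanLabellingW W (3 / 5) 10 (1 / 3) 3)
    (hSB : ShellBudgetW W (3 / 5) 100000)
    (hV : VolterraTransferBoundC (3 / 5) (1 / 3) 3 (1 / 100) (3 / 100) (1 / 2) ϱ 3 (1 / 3000000))
    (hN : HarmonicReductionW (3 / 5) (1 / 3) 3 (1 / 100) (3 / 100) (1 / 2) ϱ (1 / 3000000) W (1 / 20) 10 100000)
    (hP : ChartedChargePricingG (3 / 20) (1 / 10) (3 / 5)) : ChargedEnergyGap :=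
  chargedEnergyGap_of_harmonicLedger W hF hIP hFCP hCCP hB hLab hSB (harmonicTransferBoundC_of_volterra hV) hN hP

end Record

end Summit.AtomisticToContinuum.Crystallization.Theorems.ChargedEnergyGapChartDial

end

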